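import Summits.CriticalPhenomena.PercolationContinuityZ3.Theorems.SahiMasterFamilyCommonPivotalRestrict
import Summits.CriticalPhenomena.PercolationContinuityZ3.Theorems.SahiMasterFamilyPositiveSomewhereAssembly
import Summits.CriticalPhenomena.PercolationContinuityZ3.Theorems.SahiMasterFamilyTerminalTight
import Summits.CriticalPhenomena.PercolationContinuityZ3.Theorems.SahiMasterFamilyStrictHarris

/-!
# (P3+) `SahiE3PositiveSomewhere` is a theorem: a non-zero-flag triple of increasing events has `E₃ > 0` somewhere in the open cube

Unit `prim-masterthm-p4` (gen 12; crux anchor stmt-CriticalPhenomena-4575, helper work; memo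
`run/shared/lean/prim/prim-masterthm/prim-masterthm-p4/P4-GEN12-REPORT.md`).

Gen 10 typed (P3+) `SahiE3PositiveSomewhere` (for three increasing events on a finite product of two-point spaces that do NOT form a
zero flag, Sahi's `E₃(μ_p; 1_{U₀},1_{U₁},1_{U₂}) > 0` at SOME `p` in the open cube — the weak, "positive somewhere", form of Kahn's
Conjecture 5 / Sahi's `C₃` on product measures); gen 11 reduced it to the terminal class (proved there) and to the class statement
`SahiE3PositiveOfCommonPivotalFaceVanishing` (face-vanishing triples with a common pivotal coordinate).  This file PROVES that class
statement, hence (P3+):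

* **absorbing member** (`exists_interior_sahiE_three_pos_of_absorber`): if some member contains the other two then
  `E₃ = (2 − μ(U_l))·E₂(the other two)` (`sahiE_ind_eq_of_absorbing`), and `E₂ > 0` at `p = ½` by Harris and its equality case
  (`masterFamilyEqIff_two`: the other two share the common pivotal coordinate, so they are not determined by disjoint sets);
* **no absorbing member**: the triple is TIGHT (`principalCap_of_commonPivotal_noAbsorber`, glued frames at order three), it is not a
  zero flag (common pivotal coordinate), so the positive form of the principal-cap dichotomy (`exists_interior_sahiE_pos_of_principalCap`,
  gen 11) gives `E₃ > 0` near the sparse corner.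

**`sahiE3PositiveSomewhere_holds : SahiE3PositiveSomewhere`.**  Equivalently: a triple of increasing events with `E₃(μ_p) ≤ 0` on the
whole open cube is a zero flag (`E₃ ≡ 0`).  HONEST FRAMING: this is NOT Kahn's Conjecture 5 / Sahi's `C₃` (which ask `E₃ ≥ 0`
EVERYWHERE); those, `C_k`, and the master theorem remain OPEN.  Axioms standard. [this work]
-/

noncomputable section

open scoped Classical

namespace Summit.CriticalPhenomena.PercolationContinuityZ3.Theorems

namespace PositiveSomewhere

open Finset Function
open Literature.Combinatorics.Sahi2008
open Literature.Probability.Percolation (DeterminedBy determinedBy_iff)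
open Literature.Probability.Percolation.DecisionTree (ind ind_of_mem ind_of_not_mem)
open Literature.Probability.LatticeModels.Kahn2022 (Affects)

/-- **Absorbing member ⟹ `E₃ > 0` at the centre.**  If `U_l` contains the other two members and some coordinate is pivotal for all
three, then `E₃(μ_{½}; 1_U) = (2 − μ(U_l))·E₂(the other two) > 0`. [this work] -/
theorem exists_interior_sahiE_three_pos_of_absorber {ι : Type} [Fintype ι] (U : Fin 3 → Set (Set ι)) (hU : ∀ j, IsUpperSet (U j))
    (l : Fin 3) (habs : ∀ m, m ≠ l → U m ⊆ U l) {e : ι} (he : ∀ j, ∃ ω, e ∉ ω ∧ ω ∉ U j ∧ insert e ω ∈ U j) :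
    ∃ p : ι → unitInterval, (∀ i, (p i : ℝ) ∈ Set.Ioo (0 : ℝ) 1) ∧ 0 < sahiE (bernoulliWeight p) 3 (fun j => ind (U j)) := by
  set p : ι → unitInterval := fun _ => ⟨1 / 2, by norm_num, by norm_num⟩ with hpdef
  have hp : ∀ i, (p i : ℝ) ∈ Set.Ioo (0 : ℝ) 1 := fun i => by
    simp only [hpdef, Set.mem_Ioo]; norm_num
  refine ⟨p, hp, ?_⟩
  rw [sahiE_ind_eq_of_absorbing (bernoulliWeight p) (n := 1) U l habs]
  have hfac : 0 < ((1 : ℕ) : ℝ) + 1 - ex (bernoulliWeight p) (ind (U l)) := by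
    have := ex_bernoulliWeight_ind_le_one p (U l)
    push_cast
    linarith
  set V : Fin 2 → Set (Set ι) := fun i => U (l.succAbove i) with hVdef
  have hV : ∀ i, IsUpperSet (V i) := fun i => hU _
  have h2 : 0 ≤ sahiE (bernoulliWeight p) 2 (fun i => ind (V i)) := masterFamilyNonneg_of_le_two le_rfl ι p V hV
  have hne : sahiE (bernoulliWeight p) 2 (fun i => ind (V i)) ≠ 0 := by
    intro h0
    obtain ⟨A, B, hAB, hA, hB⟩ := (masterFamilyEqIff_two ι p hp V hV).1 h0
    have hmem : ∀ i : Fin 2, e ∈ esupp (V i) := fun i => by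
      obtain ⟨ω, -, hω, hωe⟩ := he (l.succAbove i)
      exact mem_esupp.2 ⟨ω, hω, hωe⟩
    exact Finset.disjoint_left.1 hAB (esupp_subset_of_determinedBy hA (hmem 0)) (esupp_subset_of_determinedBy hB (hmem 1))
  exact mul_pos hfac (lt_of_le_of_ne h2 hne.symm)

/-- **The common-pivotal face-vanishing class of (P3+) is a theorem**: three increasing events determined by `S`, with a coordinate
pivotal for all three and all minors at coordinates of `S` zero flags, have `E₃(μ_p; 1_U) > 0` at some interior `p`. [this work] -/
theorem sahiE3PositiveOfCommonPivotalFaceVanishing_holds : SahiE3PositiveOfCommonPivotalFaceVanishing := by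
  intro ι _ U S hU hUS hpiv hfv
  obtain ⟨e, he⟩ := id hpiv
  by_cases habs : ∃ l, ∀ m, m ≠ l → U m ⊆ U l
  · obtain ⟨l, hl⟩ := habs
    exact exists_interior_sahiE_three_pos_of_absorber U hU l hl he
  · push Not at habs
    have hpc := principalCap_of_commonPivotal_noAbsorber ι U S hU hUS hpiv hfv habs
    exact SahiSparseEnd.exists_interior_sahiE_pos_of_principalCap U hU (fun j => empty_notMem_of_pivotal (U j) (hU j) (he j)) S hpc
      (not_suppZeroFlag_three_of_common_pivotal U hU he)

/-- **(P3+) `SahiE3PositiveSomewhere`.**  For three increasing events `U₀, U₁, U₂` on a finite product of two-point spaces that do NOT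
form a zero flag (`¬ SuppZeroFlag 3 U`), Sahi's `E₃(μ_p; 1_{U₀}, 1_{U₁}, 1_{U₂})` is POSITIVE at some `p` in the open cube.
(Terminal class: gen 11; common-pivotal face-vanishing class: this file; reduction: gen 11.) [this work] -/
theorem sahiE3PositiveSomewhere_holds : SahiE3PositiveSomewhere :=
  sahiE3PositiveSomewhere_of_commonPivotalFaceVanishing sahiE3PositiveOfCommonPivotalFaceVanishing_holds

/-- **Corollary (sign dichotomy).**  If `E₃(μ_p; 1_U) ≤ 0` for EVERY `p` in the open cube, then `U` is a zero flag (so `E₃ ≡ 0`).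
[this work] -/
theorem suppZeroFlag_of_sahiE_three_nonpos {ι : Type} [Fintype ι] (U : Fin 3 → Set (Set ι)) (hU : ∀ j, IsUpperSet (U j))
    (hle : ∀ p : ι → unitInterval, (∀ i, (p i : ℝ) ∈ Set.Ioo (0 : ℝ) 1) → sahiE (bernoulliWeight p) 3 (fun j => ind (U j)) ≤ 0) :
    SuppZeroFlag 3 U := by
  by_contra hZ
  obtain ⟨p, hp, hpos⟩ := sahiE3PositiveSomewhere_holds ι U hU hZ
  exact absurd (hle p hp) (not_le.2 hpos)

end PositiveSomewhere

end Summit.CriticalPhenomena.PercolationContinuityZ3.Theorems
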